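import Summits.BirchSwinnertonDyer.BirchSwinnertonDyer.Theorems.GenusKolyvaginAtTwoMinimalTwinBSDTwoSwappedPairRationalHeegnerPoint
import HarnessLib

/-!
# Route `GenusKolyvaginAtTwo`, crux U₂ `MinimalTwinBSDTwo` (stmt-BirchSwinnertonDyer-22985), LINE 23 «twin_swap»:
# THE `2`-PRIMITIVITY CLAUSE OF S2′ IS ONE LOCAL BIT OF THE RATIONAL HEEGNER POINT — the LINE-23 twin of the reduction bit R₁

Width seat `bsd-line-gk2-p4` g26 (cell `bsd-f1-sign2`), `--supports stmt-BirchSwinnertonDyer-22985` (helper; closes nothing).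
THEOREMS ONLY (no definition, no named fact, no `sorry`); **BSD is NOT proved by any of this; U₂ / hTw is NOT proved; nothing is closed.**
Sequel of `…SwappedPairRationalHeegnerPoint` (the rational Heegner point `Y`, `ι Y = P₀ + 2u`, and «`P(1) ∈ 2E(K[1]) ⟺ κ₂(Y) = 0`»).

* §1 `exists_two_smul_completion_iff_kummer_eq_zero_of_transposition` — `#Sel₂(E) = 2`, `Δ_E < 0`, odd-`d_K` Heegner `K`, `#Sel₂(Wd) = 1`,
  `q` a transposition prime of `d_K` with the other primes silent: for EVERY `Y ∈ E(ℚ)`, **`Y ∈ 2E(ℚ_q) ⟺ κ₂(Y) = 0`** (the non-zero class of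
  `Sel₂(E) ≅ ℤ/2` is non-strict at `q` by `cor34i_twin_heegner_transposition_unramified`: strict would give `#Sel₂(Wd) = 4`);
  `exists_two_smul_real_iff_kummer_eq_zero_of_allSilent` — the same at `∞` for `Δ_E > 0`, `ord₂ C(Wd) = 0` (`T = {∞}` count
  `natCard_selmerGroup_twist_eq_mul_two_of_menu₅_inl`).
* §2 **`not_two_dvd_derivedPoint_iff_localBit_posDisc`** — on the S3′ frame's ROUTE-CONSUMED cell (`Δ_E > 0`, `C(E)` odd, all-silent
  Sel₂-trivial twin = the slice hTw0 of gk2-p3 g28's `TwinSwap.Slices.nonCMAtTwo_of_items_of_tamagawaSlicedTwin`): the rational Heegner point `Y`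
  with **`P(1) ∉ 2E(K[1]) ⟺ Y ∉ 2E(ℝ)`** (`Y` on the egg); and `…_negDisc` — the S3′ frame's other budget disjunct (`Δ_E < 0 ∧ ord₂ C(Wd) ≤ 1`,
  odd `C(E)`: in LINE 23's composition for U₂ AS TYPED, not a cell `closes` consumes): **`⟺ Y ∉ 2E(ℚ_q)`** at the transposition prime `q ∣ d_K`.
  INSTRUMENT I1-swap for -data: the real component (resp. the class in `E(ℚ_q)/2 ≅ ℤ/2`) of one rational point; no heights, no generator
  (compare gk2-p2 g23's index form `not_exists_two_smul_derivedPoint_iff_odd_index`).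

References: [GrossLMS1991] §5 Prop. 5.3; [McCallumLMS1991] §5 Lemma 5.1; [MazurRubin2010] Lemma 2.2 (i), Lemma 2.9, Prop. 3.3, Cor. 3.4 (i);
[Kramer1981] §2 Prop. 3, Prop. 6, Thm. 1; [SilvermanAEC2009] VIII §2, X §4.
-/

set_option autoImplicit false
set_option linter.dupNamespace false -- `Summit.<P>.<Sub>` repeats `BirchSwinnertonDyer` (D-0017)

noncomputable section

open scoped Classical NumberField

namespace Summit.BirchSwinnertonDyer.BirchSwinnertonDyer.Theorems.GenusExact.TwinSwapBit

open IsDedekindDomain Field NumberField WeierstrassCurve Literature.NumberTheory.EllipticCurves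
  Literature.NumberTheory.EllipticCurves.ModularForms Literature.NumberTheory.GaloisRepresentations Rat.HeightOneSpectrum
open Summit.BirchSwinnertonDyer.BirchSwinnertonDyer.Theorems.GenusExact.PlusDescent
open Summit.BirchSwinnertonDyer.BirchSwinnertonDyer.Theorems.GenusExact.TwinSwap
open Summit.BirchSwinnertonDyer.BirchSwinnertonDyer.Theorems.GenusKolyArch (hdiv_two localization_kummerMapTorsion_eq_zero_iff
  natCard_ker_nsmul_eq_of_intertwining forall_sq_ne_completion_of_neg embedding_of_isReal_rat_apply
  natCard_selmerGroup_twist_eq_mul_two_of_menu₅_inl)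
open Summit.BirchSwinnertonDyer.BirchSwinnertonDyer.Theorems.GenusKolyTwistLocal (natCard_ker_nsmul_adicCompletion_eq_padic
  exists_intertwining_master_frame exists_selmer_localization_ne_zero_of_not_le_strictLocalKer)
open Summit.BirchSwinnertonDyer.BirchSwinnertonDyer.Theorems.GenusSupplyNarrow.DepthZero (odd_addOrderOf_of_two_torsionFree)
open Summit.BirchSwinnertonDyer.Rank1Residual.X11b.Three (Koly.pDiv_one_iff_exists_zsmul_eq Koly.PDiv)

variable (W : WeierstrassCurve ℚ) [W.IsElliptic] [W.IsGloballyMinimal] {K : Type} [Field K] [NumberField K]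

/-! ## §0 Bookkeeping -/

/-- In a subgroup of order `2` the two non-zero elements coincide. [folklore] -/
private theorem eq_of_natCard_eq_two {G : Type*} [AddCommGroup G] {S : AddSubgroup G} (hS : Nat.card S = 2)
    {a b : G} (ha : a ∈ S) (hb : b ∈ S) (ha0 : a ≠ 0) (hb0 : b ≠ 0) : a = b := by
  obtain ⟨y, -, hy⟩ := (Nat.card_eq_two_iff' (⟨0, S.zero_mem⟩ : S)).mp hS
  have ha' : (⟨a, ha⟩ : S) = y := hy ⟨a, ha⟩ (fun h ↦ ha0 (congrArg Subtype.val h))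
  have hb' : (⟨b, hb⟩ : S) = y := hy ⟨b, hb⟩ (fun h ↦ hb0 (congrArg Subtype.val h))
  exact congrArg Subtype.val (ha'.trans hb'.symm)

/-! ## §1 Local halvability at the `T`-place ⟺ `κ₂ = 0`, for every rational point -/

/-- **`Y ∈ 2E(ℚ_q) ⟺ κ₂(Y) = 0` at a TRANSPOSITION prime `q ∣ d_K` (Δ_E < 0).**  `E/ℚ` globally minimal with `Δ_E < 0` and
`#Sel₂(E) = 2`; `K` imaginary quadratic with odd `d_K`, Heegner for `N_E`; `q ∣ d_K` with `#E(ℚ_q)[2] = 2`, every other prime of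
`d_K` silent; `Wd ≅ E^(d_K)` elliptic with `#Sel₂(Wd) = 1`.  If `Sel₂(E)` were strict at `q`, Cor. 3.4 (i) would give `#Sel₂(Wd) = 4`; so
the non-zero class of `Sel₂(E) ≅ ℤ/2` — the Kummer class of ANY `Y ∉ 2E(ℚ)` — is non-strict at `q`, i.e. `Y ∉ 2E(ℚ_q)`.
[cite: MazurRubin2010, Prop. 3.3, Cor. 3.4 (i)] [cite: Kramer1981, Thm. 1] [cite: SilvermanAEC2009, VIII §2, X §4] -/
theorem exists_two_smul_completion_iff_kummer_eq_zero_of_transposition (hΔ : W.Δ < 0) (hK : IsImaginaryQuadratic K)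
    (hodd : Odd (NumberField.discr K)) (hH : SatisfiesHeegnerHypothesis (W.conductorNorm ℤ) K)
    (hSel : Nat.card (W.selmerGroup 2) = 2)
    {q : ℕ} [Fact q.Prime] (hqd : (q : ℤ) ∣ NumberField.discr K)
    (hq2 : Nat.card {Q : (W.baseChange ℚ_[q]).toAffine.Point // 2 • Q = 0} = 2)
    (hT : ∀ (p : ℕ) [Fact p.Prime], (p : ℤ) ∣ NumberField.discr K → p ≠ q →
      ∀ Q : (W.baseChange ℚ_[p]).toAffine.Point, 2 • Q = 0 → Q = 0)
    (Wd : WeierstrassCurve ℚ) [Wd.IsElliptic] (hWd : ∃ C : VariableChange ℚ, C • W.quadraticTwist (NumberField.discr K : ℚ) = Wd)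
    (hSel1 : Nat.card (Wd.selmerGroup 2) = 1)
    {v₀ : HeightOneSpectrum (𝓞 ℚ)} (hv₀ : ((primesEquiv v₀ : Nat.Primes) : ℕ) = q) (Y : W.toAffine.Point) :
    (∃ R : (W.baseChange (Place.Completion (Sum.inr v₀ : Place ℚ))).toAffine.Point,
        ((2 : ℕ) : ℤ) • R = Affine.Point.baseChange (W' := W) ℚ (Place.Completion (Sum.inr v₀ : Place ℚ)) Y) ↔
      kummerMapTorsion W ((2 : ℕ) : ℤ) (hdiv_two W) Y = 0 := by
  have h20 : ((2 : ℕ) : ℤ) ≠ 0 := by norm_num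
  refine ⟨fun hloc ↦ ?_, fun h0 ↦ ?_⟩
  swap
  · -- `κ₂(Y) = 0` ⟹ `loc_q κ₂(Y) = 0` ⟹ `Y ∈ 2E(ℚ_q)` (local Kummer sequence)
    have h := (localization_kummerMapTorsion_eq_zero_iff W h20 (hdiv_two W) (Sum.inr v₀) Y).mp
      (by rw [h0]; exact AddMonoidHom.map_zero _)
    exact h
  by_contra hκ
  -- the Kummer class of `Y` is THE non-zero class of `Sel₂(E)`
  have hκS : kummerMapTorsion W _ (hdiv_two W) Y ∈ (W.kummerSelmerStructure ((2 : ℕ) : ℤ)).selmerGroup :=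
    (SetLike.ext_iff.mp (W.selmerGroup_eq_selmerGroup_kummerSelmerStructure _) _).mp
      (kummerMapTorsion_mem_selmerGroup W _ (hdiv_two W) _)
  have hcard : Nat.card ((W.kummerSelmerStructure ((2 : ℕ) : ℤ)).selmerGroup) = 2 := by
    rw [← selmerGroup_eq_selmerGroup_kummerSelmerStructure]
    exact hSel
  -- `Sel₂(E)` is NOT strict at `q`: else `#Sel₂(Wd) = 2·#Sel₂(E) = 4`
  obtain ⟨hup, -⟩ := cor34i_twin_heegner_transposition_unramified W hΔ hK hodd hH hqd hq2 hT Wd hWd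
  have hns : ¬ W.selmerGroup 2 ≤ MazurRubin2010.strictLocalKer W ℚ_[q] 2 := fun hs ↦ by
    have h := hup hs
    rw [hSel1, hSel] at h
    omega
  subst hv₀
  obtain ⟨c, hcS, hc⟩ := exists_selmer_localization_ne_zero_of_not_le_strictLocalKer W v₀ hns
  have hc0 : c ≠ 0 := fun h ↦ hc (by rw [h]; exact AddMonoidHom.map_zero _)
  rw [eq_of_natCard_eq_two hcard hcS hκS hc0 hκ, Ne,
    localization_kummerMapTorsion_eq_zero_iff W h20 (hdiv_two W) (Sum.inr v₀) Y] at hc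
  exact hc hloc

/-- **`Y ∈ 2E(ℝ) ⟺ κ₂(Y) = 0` at the REAL place (Δ_E > 0, all primes of `d_K` silent).**  `E/ℚ` globally minimal with `Δ_E > 0`, `C(E)` odd
and `#Sel₂(E) = 2`; `K` imaginary quadratic with odd `d_K`, Heegner for `N_E`; `Wd = Cd • E^(d_K)` elliptic with `ord₂ C(Wd) = 0` (every prime of
`d_K` silent) and `#Sel₂(Wd) = 1`.  If `Sel₂(E)` were strict at `∞`, the `T = {∞}` count (`natCard_selmerGroup_twist_eq_mul_two_of_menu₅_inl`)
would give `#Sel₂(Wd) = 4`; so the Kummer class of any `Y ∉ 2E(ℚ)` is non-trivial at `∞`: `Y ∉ 2E(ℝ)`, i.e. `Y` lies on the egg.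
[cite: MazurRubin2010, Lemma 2.9, Prop. 3.3, Cor. 3.4 (i)] [cite: Kramer1981, §2 Props. 3, 6, Thm. 1] -/
theorem exists_two_smul_real_iff_kummer_eq_zero_of_allSilent (hΔ : 0 < W.Δ) (hTam : Odd W.tamagawaProduct)
    (hK : IsImaginaryQuadratic K) (hodd : Odd (NumberField.discr K)) (hH : SatisfiesHeegnerHypothesis (W.conductorNorm ℤ) K)
    (hSel : Nat.card (W.selmerGroup 2) = 2)
    {Wd : WeierstrassCurve ℚ} [Wd.IsElliptic] (Cd : VariableChange ℚ) (hCd : Cd • W.quadraticTwist (NumberField.discr K : ℚ) = Wd)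
    (hDEF : padicValNat 2 Wd.tamagawaProduct = 0) (hSel1 : Nat.card (Wd.selmerGroup 2) = 1) (Y : W.toAffine.Point) :
    (∃ R : (W.baseChange (Place.Completion (Sum.inl Rat.infinitePlace : Place ℚ))).toAffine.Point,
        ((2 : ℕ) : ℤ) • R = Affine.Point.baseChange (W' := W) ℚ (Place.Completion (Sum.inl Rat.infinitePlace : Place ℚ)) Y) ↔
      kummerMapTorsion W ((2 : ℕ) : ℤ) (hdiv_two W) Y = 0 := by
  have h20 : ((2 : ℕ) : ℤ) ≠ 0 := by norm_num
  refine ⟨fun hloc ↦ ?_, fun h0 ↦ ?_⟩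
  swap
  · have h := (localization_kummerMapTorsion_eq_zero_iff W h20 (hdiv_two W) (Sum.inl Rat.infinitePlace) Y).mp
      (by rw [h0]; exact AddMonoidHom.map_zero _)
    exact h
  by_contra hκ
  have hκS : kummerMapTorsion W _ (hdiv_two W) Y ∈ (W.kummerSelmerStructure ((2 : ℕ) : ℤ)).selmerGroup :=
    (SetLike.ext_iff.mp (W.selmerGroup_eq_selmerGroup_kummerSelmerStructure _) _).mp
      (kummerMapTorsion_mem_selmerGroup W _ (hdiv_two W) _)
  have hcard : Nat.card ((W.kummerSelmerStructure ((2 : ℕ) : ℤ)).selmerGroup) = 2 := by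
    rw [← selmerGroup_eq_selmerGroup_kummerSelmerStructure]
    exact hSel
  -- the menus: every prime of `d_K` is silent for `W` and `Wd`
  have hdneg : NumberField.discr K < 0 := IsImaginaryQuadratic.discr_neg hK
  have hd0 : (NumberField.discr K : ℚ) ≠ 0 := by exact_mod_cast hdneg.ne
  have hsilQ := forall_twoTorsion_padic_eq_zero_of_padicValNat_two_tamagawaProduct_twin_eq_zero W hK hodd hH hTam Cd hCd hDEF
  obtain ⟨φ, ψ, hψφ, hφψ, -⟩ := exists_intertwining_master_frame W Wd hd0 hCd
  have hsil : ∀ v : HeightOneSpectrum (𝓞 ℚ), (((primesEquiv v : Nat.Primes) : ℕ) : ℤ) ∣ NumberField.discr K →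
      Nat.card (nsmulAddMonoidHom 2 : (W.baseChange (v.adicCompletion ℚ)).toAffine.Point →+ _).ker = 1 ∧
      Nat.card (nsmulAddMonoidHom 2 : (Wd.baseChange (v.adicCompletion ℚ)).toAffine.Point →+ _).ker = 1 := by
    intro v hvd
    haveI := Fact.mk (primesEquiv v).2
    have hker : Nat.card (nsmulAddMonoidHom 2 : (W.baseChange (v.adicCompletion ℚ)).toAffine.Point →+ _).ker = 1 := by
      rw [natCard_ker_nsmul_adicCompletion_eq_padic W v 2]
      have h0 := hsilQ ((primesEquiv v : Nat.Primes) : ℕ) hvd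
      rw [Nat.card_eq_one_iff_unique]
      exact ⟨⟨fun a b ↦ Subtype.ext ((h0 a.1 a.2).trans (h0 b.1 b.2).symm)⟩, ⟨⟨0, by simp⟩⟩⟩
    refine ⟨hker, ?_⟩
    rw [@natCard_ker_nsmul_eq_of_intertwining ℚ _ _ W Wd _ _ 2 two_ne_zero φ ψ hψφ hφψ (v.adicCompletion ℚ) _
      (HeightOneSpectrum.instAlgebraAdicCompletion (𝓞 ℚ) ℚ v) (Literature.NumberTheory.GaloisRepresentations.charZero_adicCompletion v)]
    exact hker
  have hfin := twist_place_menu₅_finite_rat_of_all_silent W hK.1 hodd hH hCd hsil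
  have hw₀ : (Rat.infinitePlace).IsReal := Rat.isReal_infinitePlace
  have hΔ' : 0 < InfinitePlace.embedding_of_isReal hw₀ W.Δ := by rwa [embedding_of_isReal_rat_apply, Rat.cast_pos]
  have hinf : ∀ w : InfinitePlace ℚ, w ≠ Rat.infinitePlace →
      (∃ s : w.Completion, s ^ 2 = algebraMap ℚ w.Completion (NumberField.discr K : ℚ)) ∨
      ((∀ x : galoisCohomology (W.localGaloisModule w.Completion) 1, x = 0) ∧
        (∀ x : galoisCohomology (Wd.localGaloisModule w.Completion) 1, x = 0)) :=
    fun w hw ↦ absurd (Subsingleton.elim w _) hw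
  have hdsq₀ := forall_sq_ne_completion_of_neg (show (NumberField.discr K : ℚ) < 0 by exact_mod_cast hdneg) Rat.infinitePlace
  -- `Sel₂(E)` is NOT strict at `∞`: else `#Sel₂(Wd) = #Sel₂(E)·2 = 4`
  have hns : ¬ ∀ c ∈ (W.kummerSelmerStructure ((2 : ℕ) : ℤ)).selmerGroup,
      galoisCohomology.localization (W.torsionGaloisModule ((2 : ℕ) : ℤ)) (Sum.inl Rat.infinitePlace) 1 c = 0 := fun hstrict ↦ by
    have h := natCard_selmerGroup_twist_eq_mul_two_of_menu₅_inl W hd0 hCd hw₀ hΔ' hdsq₀ hfin hinf hstrict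
    have h1 : Nat.card (Wd.selmerGroup ((2 : ℕ) : ℤ)) = 1 := hSel1
    have h2' : Nat.card (W.selmerGroup ((2 : ℕ) : ℤ)) = 2 := hSel
    rw [h1, h2'] at h
    omega
  push Not at hns
  obtain ⟨c, hcS, hc⟩ := hns
  have hc0 : c ≠ 0 := fun h ↦ hc (by rw [h]; exact AddMonoidHom.map_zero _)
  rw [eq_of_natCard_eq_two hcard hcS hκS hc0 hκ, Ne,
    localization_kummerMapTorsion_eq_zero_iff W h20 (hdiv_two W) (Sum.inl Rat.infinitePlace) Y] at hc
  exact hc hloc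

/-! ## §2 The instrument on LINE 23's S3′ frame -/

/-- **I1-swap (Δ_E < 0): «`P(1) ∉ 2E(K[1])`» ⟺ «the rational Heegner point is NOT halvable in `E(ℚ_q)`» at the transposition prime.**
LINE 23's S3′ frame, budget branch `Δ_E < 0 ∧ ord₂ C(Wd) ≤ 1` (a disjunct of the frame AS TYPED; by gk2-p3 g28's `TwinSwap.Slices` the route's
`closes` consumes U₂ on a Δ<0 rank-one curve only with EVEN Tamagawa product, so this odd-`C(E)` reading is frame-internal): `E/ℚ` globally
minimal of analytic rank `1` (so `w(E) = −1`), `#Sel₂(E) = 2`,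
`C(E)` odd; `K` imaginary quadratic with odd `d_K`, Heegner; a datum `Dt`, `(β, ι)`, a conductor-`1` datum `d₁` with `P(1)` of infinite
order; `Wd ≅ E^(d_K)` elliptic with `#Sel₂(Wd) = 1`.  THEN there are the TRANSPOSITION prime `q ∣ d_K` (`#E(ℚ_q)[2] = 2`, every other prime of
`d_K` silent — the one bit of `ord₂ C(Wd) = 1`), `P₀ ∈ E(K)` over `P(1)` and a RATIONAL `Y ∈ E(ℚ)` with `ι Y − P₀ ∈ 2·E(K)_tors`, and
**`P(1) ∉ 2E(K[1]) ⟺ Y ∉ 2E(ℚ_q)`** (`ℚ_q` = the completion at the place `v₀ ∋ q`).  Unconditional; credits nothing by itself.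
[cite: GrossLMS1991, §5 Prop. 5.3] [cite: McCallumLMS1991, §5 Lemma 5.1] [cite: MazurRubin2010, Cor. 3.4 (i)] [cite: Kramer1981, §2 Prop. 3] -/
theorem not_two_dvd_derivedPoint_iff_localBit_negDisc [NeZero (W.conductorNorm ℤ)]
    (hr : W.analyticRank = 1) (hSel : Nat.card (W.selmerGroup 2) = 2) (hTam : Odd W.tamagawaProduct)
    (hK : IsImaginaryQuadratic K) (hodd : Odd (NumberField.discr K)) (hH : SatisfiesHeegnerHypothesis (W.conductorNorm ℤ) K)
    (Dt : ModularParametrizationData W (W.conductorNorm ℤ)) (β : ℤ) (ι : K →+* ℂ) (d₁ : KolyvaginHeegnerData Dt β ι 1)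
    (hy : ¬ IsOfFinAddOrder d₁.derivedPoint)
    (Wd : WeierstrassCurve ℚ) [Wd.IsElliptic] (hWd : ∃ C : VariableChange ℚ, C • W.quadraticTwist (NumberField.discr K : ℚ) = Wd)
    (hSel1 : Nat.card (Wd.selmerGroup 2) = 1) (hΔ : W.Δ < 0) (hbudget : padicValNat 2 Wd.tamagawaProduct ≤ 1) :
    ∃ (q : ℕ) (_ : Fact q.Prime) (v₀ : HeightOneSpectrum (𝓞 ℚ)), (q : ℤ) ∣ NumberField.discr K ∧
      ((primesEquiv v₀ : Nat.Primes) : ℕ) = q ∧ Nat.card {Q : (W.baseChange ℚ_[q]).toAffine.Point // 2 • Q = 0} = 2 ∧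
      (∀ (p : ℕ) [Fact p.Prime], (p : ℤ) ∣ NumberField.discr K → p ≠ q → ∀ Q : (W.baseChange ℚ_[p]).toAffine.Point, 2 • Q = 0 → Q = 0) ∧
      ∃ (P₀ : (W.baseChange K).toAffine.Point) (Y : W.toAffine.Point) (u : (W.baseChange K).toAffine.Point),
        Affine.Point.map (W' := W) (algebraMap K (ringClassField K ι 1)).toRatAlgHom P₀ = d₁.derivedPoint ∧
        IsOfFinAddOrder u ∧ QuadraticDescent.incl K W Y = P₀ + (2 : ℤ) • u ∧
        ((¬ ∃ Q : (W.baseChange (ringClassField K ι 1)).toAffine.Point, (2 : ℤ) • Q = d₁.derivedPoint) ↔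
          ¬ ∃ R : (W.baseChange (Place.Completion (Sum.inr v₀ : Place ℚ))).toAffine.Point,
            ((2 : ℕ) : ℤ) • R = Affine.Point.baseChange (W' := W) ℚ (Place.Completion (Sum.inr v₀ : Place ℚ)) Y) := by
  obtain ⟨Cd, hCd⟩ := hWd
  have hw : W.rootNumber = -1 := rootNumber_eq_neg_one_of_analyticRank_eq_one W hr Dt
  -- the transposition prime: `ord₂ C(Wd)` is odd on `Δ < 0`, hence `= 1`
  have hB : padicValNat 2 Wd.tamagawaProduct = 1 := by
    obtain ⟨k, hk⟩ := odd_padicValNat_two_tamagawaProduct_twin_of_Δ_neg W hK hodd hH hTam hΔ Cd hCd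
    omega
  obtain ⟨q, hqF, hqd, hq2, hT⟩ :=
    GenusKolyTwin.exists_transposition_prime_of_padicValNat_two_tamagawaProduct_twin_eq_one W hK hodd hH hTam Cd hCd hB
  obtain ⟨v₀, hv₀⟩ : ∃ v : HeightOneSpectrum (𝓞 ℚ), ((primesEquiv v : Nat.Primes) : ℕ) = q :=
    ⟨primesEquiv.symm ⟨q, hqF.out⟩, by rw [Equiv.apply_symm_apply]⟩
  -- `E(ℚ)[2] = 0`, `E(K)[2] = 0`; the rational Heegner point
  have hT2 := noTwoTorsion_of_frame W hSel hK hH Dt β ι d₁ hy Cd hCd hSel1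
  have h2K : ∀ x : (W.baseChange K).toAffine.Point, (2 : ℤ) • x = 0 → x = 0 := fun x hx ↦
    forall_two_zsmul_baseChange_eq_zero_of_heegner W K hK hodd hH hT2 x hx
  obtain ⟨P₀, Y, u, hP₀, hu, hY⟩ := exists_rational_heegnerPoint_of_rootNumber_eq_neg_one W hK hH hw h2K Dt β ι d₁
  refine ⟨q, hqF, v₀, hqd, hv₀, hq2, hT, P₀, Y, u, hP₀, hu, hY, not_congr ?_⟩
  rw [exists_two_smul_derivedPoint_iff_kummer_eq_zero W hK hodd hH hT2 Dt β ι d₁ hP₀ hY,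
    exists_two_smul_completion_iff_kummer_eq_zero_of_transposition W hΔ hK hodd hH hSel hqd hq2 hT Wd ⟨Cd, hCd⟩ hSel1 hv₀ Y]

/-- **I1-swap (Δ_E > 0): «`P(1) ∉ 2E(K[1])`» ⟺ «the rational Heegner point is NOT halvable in `E(ℝ)`» (it lies on the egg).**
LINE 23's S3′ frame, budget branch `ord₂ C(Wd) = 0` (all primes of `d_K` silent; then `Δ_E > 0`, since on `Δ_E < 0` the twin's budget is
odd) — the cell hTw0 the route's `closes` actually consumes (gk2-p3 g28 `TwinSwap.Slices`): same binders as `not_two_dvd_derivedPoint_iff_localBit_negDisc` with `ord₂ C(Wd) = 0`.  THEN `Δ_E > 0` and for `P₀ ∈ E(K)` over `P(1)` and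
the rational `Y ∈ E(ℚ)` with `ι Y − P₀ ∈ 2·E(K)_tors`: **`P(1) ∉ 2E(K[1]) ⟺ Y ∉ 2E(ℝ)`**.  Unconditional; credits nothing by itself.
[cite: GrossLMS1991, §5 Prop. 5.3] [cite: McCallumLMS1991, §5 Lemma 5.1] [cite: MazurRubin2010, Lemma 2.9, Cor. 3.4 (i)] [cite: Kramer1981, Prop. 6] -/
theorem not_two_dvd_derivedPoint_iff_localBit_posDisc [NeZero (W.conductorNorm ℤ)]
    (hr : W.analyticRank = 1) (hSel : Nat.card (W.selmerGroup 2) = 2) (hTam : Odd W.tamagawaProduct)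
    (hK : IsImaginaryQuadratic K) (hodd : Odd (NumberField.discr K)) (hH : SatisfiesHeegnerHypothesis (W.conductorNorm ℤ) K)
    (Dt : ModularParametrizationData W (W.conductorNorm ℤ)) (β : ℤ) (ι : K →+* ℂ) (d₁ : KolyvaginHeegnerData Dt β ι 1)
    (hy : ¬ IsOfFinAddOrder d₁.derivedPoint)
    (Wd : WeierstrassCurve ℚ) [Wd.IsElliptic] (hWd : ∃ C : VariableChange ℚ, C • W.quadraticTwist (NumberField.discr K : ℚ) = Wd)
    (hSel1 : Nat.card (Wd.selmerGroup 2) = 1) (hDEF : padicValNat 2 Wd.tamagawaProduct = 0) :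
    0 < W.Δ ∧
      ∃ (P₀ : (W.baseChange K).toAffine.Point) (Y : W.toAffine.Point) (u : (W.baseChange K).toAffine.Point),
        Affine.Point.map (W' := W) (algebraMap K (ringClassField K ι 1)).toRatAlgHom P₀ = d₁.derivedPoint ∧
        IsOfFinAddOrder u ∧ QuadraticDescent.incl K W Y = P₀ + (2 : ℤ) • u ∧
        ((¬ ∃ Q : (W.baseChange (ringClassField K ι 1)).toAffine.Point, (2 : ℤ) • Q = d₁.derivedPoint) ↔
          ¬ ∃ R : (W.baseChange (Place.Completion (Sum.inl Rat.infinitePlace : Place ℚ))).toAffine.Point,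
            ((2 : ℕ) : ℤ) • R = Affine.Point.baseChange (W' := W) ℚ (Place.Completion (Sum.inl Rat.infinitePlace : Place ℚ)) Y) := by
  obtain ⟨Cd, hCd⟩ := hWd
  -- `Δ > 0`: on `Δ < 0` the budget would be odd
  have hΔne : W.Δ ≠ 0 := by rw [← WeierstrassCurve.coe_Δ']; exact W.Δ'.ne_zero
  have hpos : 0 < W.Δ := by
    rcases lt_or_gt_of_ne hΔne with hneg | hpos
    · exfalso
      obtain ⟨k, hk⟩ := odd_padicValNat_two_tamagawaProduct_twin_of_Δ_neg W hK hodd hH hTam hneg Cd hCd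
      omega
    · exact hpos
  have hw : W.rootNumber = -1 := rootNumber_eq_neg_one_of_analyticRank_eq_one W hr Dt
  have hT2 := noTwoTorsion_of_frame W hSel hK hH Dt β ι d₁ hy Cd hCd hSel1
  have h2K : ∀ x : (W.baseChange K).toAffine.Point, (2 : ℤ) • x = 0 → x = 0 := fun x hx ↦
    forall_two_zsmul_baseChange_eq_zero_of_heegner W K hK hodd hH hT2 x hx
  obtain ⟨P₀, Y, u, hP₀, hu, hY⟩ := exists_rational_heegnerPoint_of_rootNumber_eq_neg_one W hK hH hw h2K Dt β ι d₁
  refine ⟨hpos, P₀, Y, u, hP₀, hu, hY, not_congr ?_⟩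
  rw [exists_two_smul_derivedPoint_iff_kummer_eq_zero W hK hodd hH hT2 Dt β ι d₁ hP₀ hY,
    exists_two_smul_real_iff_kummer_eq_zero_of_allSilent W hpos hTam hK hodd hH hSel Cd hCd hDEF hSel1 Y]

end Summit.BirchSwinnertonDyer.BirchSwinnertonDyer.Theorems.GenusExact.TwinSwapBit

end
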